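import Summits.QuantumFields.YangMills.Theorems.VirialFluxGapRingDeficitFrameDerivative
import HarnessLib

/-!
# Route `VirialFluxGap` (YangMills): SECOND-ORDER FRAME CALCULUS on the ring group — direction assignments, the multi-direction
# translation curve, iterated frame derivatives and their commutator (toward the resolvent Euler field)

Toward the deciding crux `VirialFluxGap.PeriodicSoftness` (item stmt-QuantumFields-24141), generic-region Euler field
`X_g = ½(H + λ⋆)⁻¹g` (memo `fcl-p3-g40-RESOLVENT-EULER-FIELD-24141.md`; linear algebra ✓`VirialFluxGapResolventFieldMatrix`).  The estimates
(E1)/(E2) need the Taylor expansion of `F₀` along the ONE-PARAMETER SUBGROUP `s ↦ P·exp(sY)` that turns ALL variables at once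
(`Y = (Y_w)_w`, one `𝔰𝔲(2)` element per slice link ∕ seam site), the symmetrised frame Hessian, and the commutator of frame derivatives.
Building on ✓`VirialFluxGapRingFrameDefs` ∕ ✓`VirialFluxGapRingDeficitFrameDerivative` (w3 g58: `ringCoord`, `ringPoly`, one-variable curves,
§5 «smooth functions of the coordinates»), this file provides:

* §1 DIRECTION ASSIGNMENTS `Y : Var → M₂(ℂ)` and the right-multiplication tangent map `mulTangent Y M = (M_w·Y_w)_w` (linear in `M` and in
  `Y`); the frame derivative `frameD Y f M := Df(M)[M·Y]` of a smooth function of the coordinates (= ✓`sliceFrameDeriv`/`seamFrameDeriv` for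
  one-variable assignments), smooth again (`contDiff_frameD`), additive and homogeneous in `Y`;
* §2 the MULTI-DIRECTION CURVE `multiCurve Y s = (exp(s·Y_w))_w ∈ Ω_L`: `γ 0 = 1`, `γ (s+t) = γ s · γ t`, coordinates
  `ringCoord(P·γ s) = (M_w·exp(sY_w))_w`, ★ `hasDerivAt_ringCoord_multiCurve`, ★★ `hasDerivAt_comp_multiCurve` — for smooth `f`,
  `d/ds f(ringCoord(P·γ s)) = frameD Y f (ringCoord(P·γ s))` at EVERY `s` (so `s ↦ F₀(P·exp(sY))` has derivatives of all orders
  `frameD Y (frameD Y ⋯ ringPoly)`);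
* §3 ★★ `frameD_frameD_eq` — the second frame derivative through the ambient calculus:
  `frameD Y (frameD Z f) M = D²f(M)[M·Y, M·Z] + Df(M)[M·Y·Z]`, hence ★★ `frameD_comm` — `frameD Y (frameD Z f) − frameD Z (frameD Y f)
  = frameD (YZ − ZY) f` (symmetry of `D²f`; `[Y,Z]_w` is again skew-Hermitian and traceless);
* §4 ★ `frameD_ringPoly_eq_zero_of_zero` — at a ZERO of `F₀` every frame derivative of `ringPoly` vanishes (minimum of `F₀ ≥ 0` along the curve),
  hence the second frame derivatives of `F₀` are SYMMETRIC there (`frameD_frameD_symm_of_zero`).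

HONEST FRAMING: calculus bookkeeping; the Taylor letters with explicit polynomial constants, the kernel family and the field itself are NOT
here; ⟨24141⟩ stays OPEN; no stub / crux / rung / summit is closed; the Yang–Mills mass gap is NOT proved; no summit is proved by a line.
Definitions in this file (`mulTangent`, `frameD`, `commDir`, `multiCurve`) are problem-side plumbing (no `Prop`, no named fact); 0 `sorry`,
standard axioms.  Explicit-unit seat `ym-line-fcl-p3` g40 (cell ym-idea-1, free hands), `--supports stmt-QuantumFields-24141`.
References: [cite: arXiv220412737, §2 (2.4) (p. 10)] (left-invariant derivatives on matrix groups); [folklore].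
-/

set_option autoImplicit false

noncomputable section

open scoped Matrix BigOperators ContDiff Topology
open MeasureTheory
open Literature.MathematicalPhysics.QuantumFieldTheory hiding SU2
open Literature.MathematicalPhysics.QuantumLattice
open Literature.MathematicalPhysics.QuantumFieldTheory.SUNBakryEmery (expSU coe_expSU matTop)

namespace Summit.QuantumFields.YangMills.Theorems.VirialFluxGap.FrameHessian

open Summit.QuantumFields.YangMills.Theorems.FemtoTransferGap
open Summit.QuantumFields.YangMills.Theorems.FemtoTransferGap.TT
open Summit.QuantumFields.YangMills.Theorems.VirialFluxGap.RingDeficit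
open Summit.QuantumFields.YangMills.Theorems.VirialFluxGap.FrameDerivative

variable {L : ℕ} [NeZero L]

open scoped Matrix.Norms.Frobenius

attribute [local instance 2000] Literature.MathematicalPhysics.QuantumFieldTheory.SUNBakryEmery.matTop

/-! ## §1 Direction assignments, the tangent map and the frame derivative of a smooth function of the coordinates -/

omit [NeZero L] in
/-- The right-multiplication TANGENT MAP of a direction assignment `Y` (one matrix per slice link ∕ seam site): `M ↦ (M_w · Y_w)_w`.
For a one-variable assignment this is ✓`sliceTangent`/`seamTangent` (via `sliceTangent_eq`). [cite: arXiv220412737, §2 (2.4) (p. 10)] -/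
def mulTangent (Y : ((Fin (2 * L - 1 + 1) × Edge 3 L) ⊕ Site 3 L) → Matrix (Fin 2) (Fin 2) ℂ) (M : ((Fin (2 * L - 1 + 1) → Edge 3 L → Matrix (Fin 2) (Fin 2) ℂ) × (Site 3 L → Matrix (Fin 2) (Fin 2) ℂ))) : ((Fin (2 * L - 1 + 1) → Edge 3 L → Matrix (Fin 2) (Fin 2) ℂ) × (Site 3 L → Matrix (Fin 2) (Fin 2) ℂ)) :=
  (fun i e => M.1 i e * Y (Sum.inl (i, e)), fun x => M.2 x * Y (Sum.inr x))

omit [NeZero L] in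
/-- The pointwise commutator of two direction assignments, `[Y,Z]_w = Y_wZ_w − Z_wY_w`. [folklore] -/
def commDir (Y Z : ((Fin (2 * L - 1 + 1) × Edge 3 L) ⊕ Site 3 L) → Matrix (Fin 2) (Fin 2) ℂ) : ((Fin (2 * L - 1 + 1) × Edge 3 L) ⊕ Site 3 L) → Matrix (Fin 2) (Fin 2) ℂ :=
  fun w => Y w * Z w - Z w * Y w

/-- The FRAME DERIVATIVE of a function of the coordinates along the assignment `Y`: `frameD Y f M = Df(M)[(M_w·Y_w)_w]`. [cite: arXiv220412737, §2 (2.4) (p. 10)] -/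
def frameD (Y : ((Fin (2 * L - 1 + 1) × Edge 3 L) ⊕ Site 3 L) → Matrix (Fin 2) (Fin 2) ℂ) (f : ((Fin (2 * L - 1 + 1) → Edge 3 L → Matrix (Fin 2) (Fin 2) ℂ) × (Site 3 L → Matrix (Fin 2) (Fin 2) ℂ)) → ℝ) (M : ((Fin (2 * L - 1 + 1) → Edge 3 L → Matrix (Fin 2) (Fin 2) ℂ) × (Site 3 L → Matrix (Fin 2) (Fin 2) ℂ))) : ℝ :=
  fderiv ℝ f M (mulTangent Y M)

omit [NeZero L] in
/-- `mulTangent` is additive in the point. [folklore] -/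
theorem mulTangent_add_pt (Y : ((Fin (2 * L - 1 + 1) × Edge 3 L) ⊕ Site 3 L) → Matrix (Fin 2) (Fin 2) ℂ) (M M' : ((Fin (2 * L - 1 + 1) → Edge 3 L → Matrix (Fin 2) (Fin 2) ℂ) × (Site 3 L → Matrix (Fin 2) (Fin 2) ℂ))) :
    mulTangent Y (M + M') = mulTangent Y M + mulTangent Y M' := by
  unfold mulTangent
  refine Prod.ext ?_ ?_
  · funext i e; simp only [Prod.fst_add, Pi.add_apply, Matrix.add_mul]
  · funext x; simp only [Prod.snd_add, Pi.add_apply, Matrix.add_mul]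

omit [NeZero L] in
/-- `mulTangent` is homogeneous in the point. [folklore] -/
theorem mulTangent_smul_pt (Y : ((Fin (2 * L - 1 + 1) × Edge 3 L) ⊕ Site 3 L) → Matrix (Fin 2) (Fin 2) ℂ) (r : ℝ) (M : ((Fin (2 * L - 1 + 1) → Edge 3 L → Matrix (Fin 2) (Fin 2) ℂ) × (Site 3 L → Matrix (Fin 2) (Fin 2) ℂ))) :
    mulTangent Y (r • M) = r • mulTangent Y M := by
  unfold mulTangent
  refine Prod.ext ?_ ?_
  · funext i e; simp only [Prod.smul_fst, Pi.smul_apply, Matrix.smul_mul]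
  · funext x; simp only [Prod.smul_snd, Pi.smul_apply, Matrix.smul_mul]

omit [NeZero L] in
/-- `mulTangent` is additive in the assignment. [folklore] -/
theorem mulTangent_add_dir (Y Z : ((Fin (2 * L - 1 + 1) × Edge 3 L) ⊕ Site 3 L) → Matrix (Fin 2) (Fin 2) ℂ) (M : ((Fin (2 * L - 1 + 1) → Edge 3 L → Matrix (Fin 2) (Fin 2) ℂ) × (Site 3 L → Matrix (Fin 2) (Fin 2) ℂ))) :
    mulTangent (Y + Z) M = mulTangent Y M + mulTangent Z M := by
  unfold mulTangent
  refine Prod.ext ?_ ?_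
  · funext i e; simp only [Pi.add_apply, Prod.fst_add, Matrix.mul_add]
  · funext x; simp only [Pi.add_apply, Prod.snd_add, Matrix.mul_add]

omit [NeZero L] in
/-- `mulTangent` is homogeneous in the assignment. [folklore] -/
theorem mulTangent_smul_dir (r : ℝ) (Y : ((Fin (2 * L - 1 + 1) × Edge 3 L) ⊕ Site 3 L) → Matrix (Fin 2) (Fin 2) ℂ) (M : ((Fin (2 * L - 1 + 1) → Edge 3 L → Matrix (Fin 2) (Fin 2) ℂ) × (Site 3 L → Matrix (Fin 2) (Fin 2) ℂ))) :
    mulTangent (r • Y) M = r • mulTangent Y M := by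
  unfold mulTangent
  refine Prod.ext ?_ ?_
  · funext i e; simp only [Pi.smul_apply, Prod.smul_fst, Matrix.mul_smul]
  · funext x; simp only [Pi.smul_apply, Prod.smul_snd, Matrix.mul_smul]

omit [NeZero L] in
/-- Composition of tangent maps: `mulTangent Z (mulTangent Y M) = (M_w·Y_w·Z_w)_w = mulTangent (Y·Z) M`. [folklore] -/
theorem mulTangent_mulTangent (Y Z : ((Fin (2 * L - 1 + 1) × Edge 3 L) ⊕ Site 3 L) → Matrix (Fin 2) (Fin 2) ℂ) (M : ((Fin (2 * L - 1 + 1) → Edge 3 L → Matrix (Fin 2) (Fin 2) ℂ) × (Site 3 L → Matrix (Fin 2) (Fin 2) ℂ))) :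
    mulTangent Z (mulTangent Y M) = mulTangent (fun w => Y w * Z w) M := by
  unfold mulTangent
  refine Prod.ext ?_ ?_
  · funext i e; simp only [Matrix.mul_assoc]
  · funext x; simp only [Matrix.mul_assoc]

omit [NeZero L] in
/-- The tangent map is a continuous linear map of the point (finite dimensions). [folklore] -/
theorem mulTangent_isLinear (Y : ((Fin (2 * L - 1 + 1) × Edge 3 L) ⊕ Site 3 L) → Matrix (Fin 2) (Fin 2) ℂ) :
    ∃ T : ((Fin (2 * L - 1 + 1) → Edge 3 L → Matrix (Fin 2) (Fin 2) ℂ) × (Site 3 L → Matrix (Fin 2) (Fin 2) ℂ)) →L[ℝ] ((Fin (2 * L - 1 + 1) → Edge 3 L → Matrix (Fin 2) (Fin 2) ℂ) × (Site 3 L → Matrix (Fin 2) (Fin 2) ℂ)), ∀ M, T M = mulTangent Y M := by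
  have hcont : Continuous (mulTangent (L := L) Y) := by
    unfold mulTangent
    have h1 : Continuous (fun M : ((Fin (2 * L - 1 + 1) → Edge 3 L → Matrix (Fin 2) (Fin 2) ℂ) × (Site 3 L → Matrix (Fin 2) (Fin 2) ℂ)) => M.1) := continuous_fst
    have h1' : Continuous (fun M : ((Fin (2 * L - 1 + 1) → Edge 3 L → Matrix (Fin 2) (Fin 2) ℂ) × (Site 3 L → Matrix (Fin 2) (Fin 2) ℂ)) => M.2) := continuous_snd
    refine Continuous.prodMk ?_ ?_
    · refine continuous_pi fun i => continuous_pi fun e => ?_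
      have h2 : Continuous (fun N : Fin (2 * L - 1 + 1) → Edge 3 L → Matrix (Fin 2) (Fin 2) ℂ => N i) := continuous_apply i
      have h3 : Continuous (fun N : Edge 3 L → Matrix (Fin 2) (Fin 2) ℂ => N e) := continuous_apply e
      exact (h3.comp (h2.comp h1)).mul continuous_const
    · refine continuous_pi fun x => ?_
      have h3 : Continuous (fun N : Site 3 L → Matrix (Fin 2) (Fin 2) ℂ => N x) := continuous_apply x
      exact (h3.comp h1').mul continuous_const
  let T : ((Fin (2 * L - 1 + 1) → Edge 3 L → Matrix (Fin 2) (Fin 2) ℂ) × (Site 3 L → Matrix (Fin 2) (Fin 2) ℂ)) →L[ℝ] ((Fin (2 * L - 1 + 1) → Edge 3 L → Matrix (Fin 2) (Fin 2) ℂ) × (Site 3 L → Matrix (Fin 2) (Fin 2) ℂ)) :=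
    { toFun := mulTangent Y
      map_add' := mulTangent_add_pt Y
      map_smul' := fun r M => by rw [mulTangent_smul_pt]; rfl
      cont := hcont }
  exact ⟨T, fun M => rfl⟩

/-- ★ Frame derivatives of smooth functions of the coordinates are smooth (so the frame calculus iterates). [folklore] -/
theorem contDiff_frameD {f : ((Fin (2 * L - 1 + 1) → Edge 3 L → Matrix (Fin 2) (Fin 2) ℂ) × (Site 3 L → Matrix (Fin 2) (Fin 2) ℂ)) → ℝ} (hf : ContDiff ℝ ∞ f) (Y : ((Fin (2 * L - 1 + 1) × Edge 3 L) ⊕ Site 3 L) → Matrix (Fin 2) (Fin 2) ℂ) :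
    ContDiff ℝ ∞ (frameD Y f) := by
  obtain ⟨T, hT⟩ := mulTangent_isLinear (L := L) Y
  have h1 : ContDiff ℝ ∞ (fderiv ℝ f) := hf.fderiv_right (m := ∞) le_rfl
  have h2 : ContDiff ℝ ∞ fun M : ((Fin (2 * L - 1 + 1) → Edge 3 L → Matrix (Fin 2) (Fin 2) ℂ) × (Site 3 L → Matrix (Fin 2) (Fin 2) ℂ)) => T M := T.contDiff
  have heq : frameD Y f = fun M => (fderiv ℝ f M) (T M) := funext fun M => by rw [frameD, hT]
  rw [heq]
  exact h1.clm_apply h2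

omit [NeZero L] in
/-- The frame derivative is additive in the assignment. [folklore] -/
theorem frameD_add_dir (Y Z : ((Fin (2 * L - 1 + 1) × Edge 3 L) ⊕ Site 3 L) → Matrix (Fin 2) (Fin 2) ℂ) (f : ((Fin (2 * L - 1 + 1) → Edge 3 L → Matrix (Fin 2) (Fin 2) ℂ) × (Site 3 L → Matrix (Fin 2) (Fin 2) ℂ)) → ℝ) (M : ((Fin (2 * L - 1 + 1) → Edge 3 L → Matrix (Fin 2) (Fin 2) ℂ) × (Site 3 L → Matrix (Fin 2) (Fin 2) ℂ))) :
    frameD (Y + Z) f M = frameD Y f M + frameD Z f M := by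
  rw [frameD, frameD, frameD, mulTangent_add_dir, map_add]

omit [NeZero L] in
/-- The frame derivative is homogeneous in the assignment. [folklore] -/
theorem frameD_smul_dir (r : ℝ) (Y : ((Fin (2 * L - 1 + 1) × Edge 3 L) ⊕ Site 3 L) → Matrix (Fin 2) (Fin 2) ℂ) (f : ((Fin (2 * L - 1 + 1) → Edge 3 L → Matrix (Fin 2) (Fin 2) ℂ) × (Site 3 L → Matrix (Fin 2) (Fin 2) ℂ)) → ℝ) (M : ((Fin (2 * L - 1 + 1) → Edge 3 L → Matrix (Fin 2) (Fin 2) ℂ) × (Site 3 L → Matrix (Fin 2) (Fin 2) ℂ))) :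
    frameD (r • Y) f M = r * frameD Y f M := by
  rw [frameD, frameD, mulTangent_smul_dir, map_smul, smul_eq_mul]

omit [NeZero L] in
/-- The frame derivative along a finite linear combination of assignments. [folklore] -/
theorem frameD_sum_smul_dir {ι : Type*} (s : Finset ι) (u : ι → ℝ) (Y : ι → ((Fin (2 * L - 1 + 1) × Edge 3 L) ⊕ Site 3 L) → Matrix (Fin 2) (Fin 2) ℂ) (f : ((Fin (2 * L - 1 + 1) → Edge 3 L → Matrix (Fin 2) (Fin 2) ℂ) × (Site 3 L → Matrix (Fin 2) (Fin 2) ℂ)) → ℝ) (M : ((Fin (2 * L - 1 + 1) → Edge 3 L → Matrix (Fin 2) (Fin 2) ℂ) × (Site 3 L → Matrix (Fin 2) (Fin 2) ℂ))) :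
    frameD (∑ j ∈ s, u j • Y j) f M = ∑ j ∈ s, u j * frameD (Y j) f M := by
  classical
  induction s using Finset.induction_on with
  | empty =>
    simp only [Finset.sum_empty]
    rw [frameD]
    have : mulTangent (L := L) (0 : ((Fin (2 * L - 1 + 1) × Edge 3 L) ⊕ Site 3 L) → Matrix (Fin 2) (Fin 2) ℂ) M = 0 := by
      unfold mulTangent; refine Prod.ext ?_ ?_ <;> funext <;> simp
    rw [this, map_zero]
  | insert a s ha ih => rw [Finset.sum_insert ha, Finset.sum_insert ha, frameD_add_dir, frameD_smul_dir, ih]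

/-- The slice frame derivative of w3's one-variable curve is `frameD` of the one-variable assignment. [folklore] -/
theorem sliceFrameDeriv_eq_frameD (i : Fin (2 * L - 1 + 1)) (e : Edge 3 L) (Y : Matrix (Fin 2) (Fin 2) ℂ) (P : ((Fin (2 * L - 1 + 1) → GaugeConfig 3 L SU2) × (Site 3 L → SU2))) :
    sliceFrameDeriv i e Y P =
      frameD (fun w => if w = Sum.inl (i, e) then Y else 0) (ringPoly L) (ringCoord L P) := by
  rw [sliceFrameDeriv, frameD, sliceTangent_eq]
  congr 1
  unfold mulTangent
  refine Prod.ext ?_ ?_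
  · funext i' e'
    dsimp only
    simp only [sliceDir, Sum.inl.injEq, Prod.mk.injEq]
  · funext x
    dsimp only
    simp

/-- The seam frame derivative of w3's one-variable curve is `frameD` of the one-variable assignment. [folklore] -/
theorem seamFrameDeriv_eq_frameD (x : Site 3 L) (Y : Matrix (Fin 2) (Fin 2) ℂ) (P : ((Fin (2 * L - 1 + 1) → GaugeConfig 3 L SU2) × (Site 3 L → SU2))) :
    seamFrameDeriv x Y P = frameD (fun w => if w = Sum.inr x then Y else 0) (ringPoly L) (ringCoord L P) := by
  rw [seamFrameDeriv, frameD, seamTangent_eq]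
  congr 1
  unfold mulTangent
  refine Prod.ext ?_ ?_
  · funext i' e'
    dsimp only
    simp
  · funext x'
    dsimp only
    simp only [seamDir, Sum.inr.injEq]

/-! ## §2 The multi-direction translation curve -/

omit [NeZero L] in
/-- The MULTI-DIRECTION CURVE: every variable turned to the right along its own one-parameter subgroup, `(exp(s·Y_w))_w ∈ Ω_L`
(`Y_w` skew-Hermitian and traceless). [folklore] -/
def multiCurve (Y : ((Fin (2 * L - 1 + 1) × Edge 3 L) ⊕ Site 3 L) → Matrix (Fin 2) (Fin 2) ℂ) (hY : ∀ w, (Y w)ᴴ = -Y w) (hY0 : ∀ w, (Y w).trace = 0) (s : ℝ) : ((Fin (2 * L - 1 + 1) → GaugeConfig 3 L SU2) × (Site 3 L → SU2)) :=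
  (fun i e => expSU (N := 2) (hY (Sum.inl (i, e))) (hY0 (Sum.inl (i, e))) s,
    fun x => expSU (N := 2) (hY (Sum.inr x)) (hY0 (Sum.inr x)) s)

omit [NeZero L] in
/-- The multi-direction curve starts at the identity. [folklore] -/
theorem multiCurve_zero (Y : ((Fin (2 * L - 1 + 1) × Edge 3 L) ⊕ Site 3 L) → Matrix (Fin 2) (Fin 2) ℂ) (hY : ∀ w, (Y w)ᴴ = -Y w) (hY0 : ∀ w, (Y w).trace = 0) :
    multiCurve Y hY hY0 0 = 1 := by
  unfold multiCurve
  refine Prod.ext ?_ ?_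
  · funext i e; dsimp only; rw [FrameDerivative.expSU_zero]; rfl
  · funext x; dsimp only; rw [FrameDerivative.expSU_zero]; rfl

omit [NeZero L] in
/-- The multi-direction curve is a one-parameter subgroup. [folklore] -/
theorem multiCurve_add (Y : ((Fin (2 * L - 1 + 1) × Edge 3 L) ⊕ Site 3 L) → Matrix (Fin 2) (Fin 2) ℂ) (hY : ∀ w, (Y w)ᴴ = -Y w) (hY0 : ∀ w, (Y w).trace = 0) (s t : ℝ) :
    multiCurve Y hY hY0 (s + t) = multiCurve Y hY hY0 s * multiCurve Y hY hY0 t := by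
  unfold multiCurve
  refine Prod.ext ?_ ?_
  · funext i e; dsimp only [Prod.fst_mul, Pi.mul_apply]; rw [FrameDerivative.expSU_add]
  · funext x; dsimp only [Prod.snd_mul, Pi.mul_apply]; rw [FrameDerivative.expSU_add]

/-- ★ Coordinates along the multi-direction curve: `ringCoord(P·γ s) = (M_w · exp(s·Y_w))_w`. [folklore] -/
theorem ringCoord_mul_multiCurve (Y : ((Fin (2 * L - 1 + 1) × Edge 3 L) ⊕ Site 3 L) → Matrix (Fin 2) (Fin 2) ℂ) (hY : ∀ w, (Y w)ᴴ = -Y w) (hY0 : ∀ w, (Y w).trace = 0)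
    (P : ((Fin (2 * L - 1 + 1) → GaugeConfig 3 L SU2) × (Site 3 L → SU2))) (s : ℝ) :
    ringCoord L (P * multiCurve Y hY hY0 s) =
      ((fun i e => (P.1 i e : Matrix (Fin 2) (Fin 2) ℂ) * NormedSpace.exp (s • Y (Sum.inl (i, e))),
        fun x => (P.2 x : Matrix (Fin 2) (Fin 2) ℂ) * NormedSpace.exp (s • Y (Sum.inr x))) : ((Fin (2 * L - 1 + 1) → Edge 3 L → Matrix (Fin 2) (Fin 2) ℂ) × (Site 3 L → Matrix (Fin 2) (Fin 2) ℂ))) := by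
  unfold ringCoord multiCurve
  refine Prod.ext ?_ ?_
  · funext i e
    simp only [Prod.fst_mul, Pi.mul_apply, Submonoid.coe_mul, coe_expSU]
    rfl
  · funext x
    simp only [Prod.snd_mul, Pi.mul_apply, Submonoid.coe_mul, coe_expSU]
    rfl

/-- ★ The coordinates along the multi-direction curve are differentiable, with derivative the tangent map at the moving point. [folklore] -/
theorem hasDerivAt_ringCoord_multiCurve (Y : ((Fin (2 * L - 1 + 1) × Edge 3 L) ⊕ Site 3 L) → Matrix (Fin 2) (Fin 2) ℂ) (hY : ∀ w, (Y w)ᴴ = -Y w) (hY0 : ∀ w, (Y w).trace = 0)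
    (P : ((Fin (2 * L - 1 + 1) → GaugeConfig 3 L SU2) × (Site 3 L → SU2))) (t : ℝ) :
    HasDerivAt (fun s => ringCoord L (P * multiCurve Y hY hY0 s)) (mulTangent Y (ringCoord L (P * multiCurve Y hY hY0 t))) t := by
  have heq : (fun s => ringCoord L (P * multiCurve Y hY hY0 s)) = fun s =>
      (((fun i e => (P.1 i e : Matrix (Fin 2) (Fin 2) ℂ) * NormedSpace.exp (s • Y (Sum.inl (i, e))),
        fun x => (P.2 x : Matrix (Fin 2) (Fin 2) ℂ) * NormedSpace.exp (s • Y (Sum.inr x))) : ((Fin (2 * L - 1 + 1) → Edge 3 L → Matrix (Fin 2) (Fin 2) ℂ) × (Site 3 L → Matrix (Fin 2) (Fin 2) ℂ)))) :=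
    funext fun s => ringCoord_mul_multiCurve Y hY hY0 P s
  rw [heq]
  have htan : mulTangent Y (ringCoord L (P * multiCurve Y hY hY0 t)) =
      (((fun i e => (P.1 i e : Matrix (Fin 2) (Fin 2) ℂ) * (Y (Sum.inl (i, e)) * NormedSpace.exp (t • Y (Sum.inl (i, e))))),
        fun x => (P.2 x : Matrix (Fin 2) (Fin 2) ℂ) * (Y (Sum.inr x) * NormedSpace.exp (t • Y (Sum.inr x)))) : ((Fin (2 * L - 1 + 1) → Edge 3 L → Matrix (Fin 2) (Fin 2) ℂ) × (Site 3 L → Matrix (Fin 2) (Fin 2) ℂ))) := by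
    rw [ringCoord_mul_multiCurve]
    unfold mulTangent
    refine Prod.ext ?_ ?_
    · funext i e
      dsimp only
      rw [Matrix.mul_assoc, ← exp_smul_comm]
    · funext x
      dsimp only
      rw [Matrix.mul_assoc, ← exp_smul_comm]
  rw [htan]
  refine HasDerivAt.prodMk ?_ ?_
  · refine hasDerivAt_pi.2 fun i => hasDerivAt_pi.2 fun e => ?_
    exact (hasDerivAt_exp_smul_const' (𝕂 := ℝ) (Y (Sum.inl (i, e))) t).const_mul _
  · refine hasDerivAt_pi.2 fun x => ?_
    exact (hasDerivAt_exp_smul_const' (𝕂 := ℝ) (Y (Sum.inr x)) t).const_mul _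

/-- ★★ **Chain rule along the multi-direction curve for any smooth function of the coordinates**:
`d/ds f(ringCoord(P·γ s)) = frameD Y f (ringCoord(P·γ s))` at every `s`. [cite: arXiv220412737, §2 (2.4) (p. 10)] -/
theorem hasDerivAt_comp_multiCurve {f : ((Fin (2 * L - 1 + 1) → Edge 3 L → Matrix (Fin 2) (Fin 2) ℂ) × (Site 3 L → Matrix (Fin 2) (Fin 2) ℂ)) → ℝ} (hf : ContDiff ℝ ∞ f) (Y : ((Fin (2 * L - 1 + 1) × Edge 3 L) ⊕ Site 3 L) → Matrix (Fin 2) (Fin 2) ℂ)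
    (hY : ∀ w, (Y w)ᴴ = -Y w) (hY0 : ∀ w, (Y w).trace = 0) (P : ((Fin (2 * L - 1 + 1) → GaugeConfig 3 L SU2) × (Site 3 L → SU2))) (t : ℝ) :
    HasDerivAt (fun s => f (ringCoord L (P * multiCurve Y hY hY0 s)))
      (frameD Y f (ringCoord L (P * multiCurve Y hY hY0 t))) t :=
  ((hf.differentiable (by simp) _).hasFDerivAt).comp_hasDerivAt t (hasDerivAt_ringCoord_multiCurve Y hY hY0 P t)

/-- ★ The deficit along the multi-direction curve: `d/ds F₀(P·γ s) = frameD Y ringPoly (ringCoord(P·γ s))`. [folklore] -/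
theorem hasDerivAt_ringDeficit_multiCurve (Y : ((Fin (2 * L - 1 + 1) × Edge 3 L) ⊕ Site 3 L) → Matrix (Fin 2) (Fin 2) ℂ) (hY : ∀ w, (Y w)ᴴ = -Y w) (hY0 : ∀ w, (Y w).trace = 0)
    (P : ((Fin (2 * L - 1 + 1) → GaugeConfig 3 L SU2) × (Site 3 L → SU2))) (t : ℝ) :
    HasDerivAt (fun s => ringDeficit L (fun _ => false) (P * multiCurve Y hY hY0 s))
      (frameD Y (ringPoly L) (ringCoord L (P * multiCurve Y hY hY0 t))) t := by
  have heq : (fun s => ringDeficit L (fun _ => false) (P * multiCurve Y hY hY0 s)) =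
      fun s => ringPoly L (ringCoord L (P * multiCurve Y hY hY0 s)) := funext fun s => ringDeficit_eq_ringPoly _
  rw [heq]
  exact hasDerivAt_comp_multiCurve (contDiff_ringPoly (L := L)) Y hY hY0 P t

/-! ## §3 The second frame derivative and the commutator of frame derivatives -/

/-- ★★ **The second frame derivative through the ambient calculus**: for smooth `f`,
`frameD Y (frameD Z f) M = D²f(M)[M·Y][M·Z] + Df(M)[M·Y·Z]`. [folklore] -/
theorem frameD_frameD_eq {f : ((Fin (2 * L - 1 + 1) → Edge 3 L → Matrix (Fin 2) (Fin 2) ℂ) × (Site 3 L → Matrix (Fin 2) (Fin 2) ℂ)) → ℝ} (hf : ContDiff ℝ ∞ f) (Y Z : ((Fin (2 * L - 1 + 1) × Edge 3 L) ⊕ Site 3 L) → Matrix (Fin 2) (Fin 2) ℂ) (M : ((Fin (2 * L - 1 + 1) → Edge 3 L → Matrix (Fin 2) (Fin 2) ℂ) × (Site 3 L → Matrix (Fin 2) (Fin 2) ℂ))) :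
    frameD Y (frameD Z f) M =
      fderiv ℝ (fderiv ℝ f) M (mulTangent Y M) (mulTangent Z M) + fderiv ℝ f M (mulTangent (fun w => Y w * Z w) M) := by
  obtain ⟨T, hT⟩ := mulTangent_isLinear (L := L) Z
  have hfd : ∀ M', frameD Z f M' = (fderiv ℝ f M') (T M') := fun M' => by rw [frameD, hT]
  have heq : frameD Z f = fun M' => (fderiv ℝ f M') (T M') := funext hfd
  rw [frameD, heq]
  have hc : DifferentiableAt ℝ (fderiv ℝ f) M :=
    ((hf.fderiv_right (m := ∞) le_rfl).differentiable (by simp)) M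
  have hu : DifferentiableAt ℝ (fun M' : ((Fin (2 * L - 1 + 1) → Edge 3 L → Matrix (Fin 2) (Fin 2) ℂ) × (Site 3 L → Matrix (Fin 2) (Fin 2) ℂ)) => T M') M := T.differentiableAt
  rw [fderiv_clm_apply hc hu]
  simp only [_root_.add_apply, ContinuousLinearMap.comp_apply, ContinuousLinearMap.flip_apply]
  rw [T.fderiv, hT, hT, mulTangent_mulTangent, add_comm]

/-- ★★ **Commutator of frame derivatives**: `frameD Y (frameD Z f) − frameD Z (frameD Y f) = frameD (Y·Z − Z·Y) f` (symmetry of the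
ambient second derivative of a `C^∞` function over `ℝ`). [folklore] -/
theorem frameD_comm {f : ((Fin (2 * L - 1 + 1) → Edge 3 L → Matrix (Fin 2) (Fin 2) ℂ) × (Site 3 L → Matrix (Fin 2) (Fin 2) ℂ)) → ℝ} (hf : ContDiff ℝ ∞ f) (Y Z : ((Fin (2 * L - 1 + 1) × Edge 3 L) ⊕ Site 3 L) → Matrix (Fin 2) (Fin 2) ℂ) (M : ((Fin (2 * L - 1 + 1) → Edge 3 L → Matrix (Fin 2) (Fin 2) ℂ) × (Site 3 L → Matrix (Fin 2) (Fin 2) ℂ))) :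
    frameD Y (frameD Z f) M - frameD Z (frameD Y f) M = frameD (commDir Y Z) f M := by
  rw [frameD_frameD_eq hf, frameD_frameD_eq hf]
  have hsymm : fderiv ℝ (fderiv ℝ f) M (mulTangent Y M) (mulTangent Z M) =
      fderiv ℝ (fderiv ℝ f) M (mulTangent Z M) (mulTangent Y M) :=
    (hf.contDiffAt.isSymmSndFDerivAt (by rw [minSmoothness_of_isRCLikeNormedField]; norm_cast)) _ _
  rw [hsymm, frameD]
  have hdir : mulTangent (commDir Y Z) M = mulTangent (fun w => Y w * Z w) M - mulTangent (fun w => Z w * Y w) M := by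
    unfold mulTangent commDir
    refine Prod.ext ?_ ?_
    · funext i e; simp only [Prod.fst_sub, Pi.sub_apply, Matrix.mul_sub]
    · funext x; simp only [Prod.snd_sub, Pi.sub_apply, Matrix.mul_sub]
  rw [hdir, map_sub]
  ring

omit [NeZero L] in
/-- The commutator assignment of skew-Hermitian assignments is skew-Hermitian. [folklore] -/
theorem commDir_conjTranspose {Y Z : ((Fin (2 * L - 1 + 1) × Edge 3 L) ⊕ Site 3 L) → Matrix (Fin 2) (Fin 2) ℂ} (hY : ∀ w, (Y w)ᴴ = -Y w) (hZ : ∀ w, (Z w)ᴴ = -Z w)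
    (w : ((Fin (2 * L - 1 + 1) × Edge 3 L) ⊕ Site 3 L)) : (commDir Y Z w)ᴴ = -commDir Y Z w := by
  unfold commDir
  rw [Matrix.conjTranspose_sub, Matrix.conjTranspose_mul, Matrix.conjTranspose_mul, hY, hZ]
  simp only [Matrix.neg_mul, Matrix.mul_neg, neg_neg, neg_sub]

omit [NeZero L] in
/-- The commutator assignment is traceless. [folklore] -/
theorem commDir_trace (Y Z : ((Fin (2 * L - 1 + 1) × Edge 3 L) ⊕ Site 3 L) → Matrix (Fin 2) (Fin 2) ℂ) (w : ((Fin (2 * L - 1 + 1) × Edge 3 L) ⊕ Site 3 L)) : (commDir Y Z w).trace = 0 := by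
  unfold commDir
  rw [Matrix.trace_sub, Matrix.trace_mul_comm, sub_self]

/-! ## §4 At a zero of the deficit every frame derivative of `ringPoly` vanishes -/

/-- ★ At a zero of `F₀` the frame derivative of `ringPoly` along ANY skew-Hermitian traceless assignment vanishes (`F₀ ≥ 0` has a minimum
along the multi-direction curve). [folklore] -/
theorem frameD_ringPoly_eq_zero_of_zero (Y : ((Fin (2 * L - 1 + 1) × Edge 3 L) ⊕ Site 3 L) → Matrix (Fin 2) (Fin 2) ℂ) (hY : ∀ w, (Y w)ᴴ = -Y w) (hY0 : ∀ w, (Y w).trace = 0)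
    {p : ((Fin (2 * L - 1 + 1) → GaugeConfig 3 L SU2) × (Site 3 L → SU2))} (hp : ringDeficit L (fun _ => false) p = 0) :
    frameD Y (ringPoly L) (ringCoord L p) = 0 := by
  have hd := hasDerivAt_ringDeficit_multiCurve Y hY hY0 p 0
  rw [multiCurve_zero, mul_one] at hd
  have hmin : IsLocalMin (fun s => ringDeficit L (fun _ => false) (p * multiCurve Y hY hY0 s)) 0 := by
    refine Filter.Eventually.of_forall fun s => ?_
    dsimp only
    rw [multiCurve_zero, mul_one, hp]
    exact ringDeficit_nonneg _ _
  exact hmin.hasDerivAt_eq_zero hd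

/-- ★ At a zero of `F₀` the second frame derivatives of `ringPoly` are SYMMETRIC: `∂_Y∂_Z F₀ = ∂_Z∂_Y F₀` (the commutator is a first
derivative along `[Y,Z]`, which vanishes there). [folklore] -/
theorem frameD_frameD_symm_of_zero {Y Z : ((Fin (2 * L - 1 + 1) × Edge 3 L) ⊕ Site 3 L) → Matrix (Fin 2) (Fin 2) ℂ} (hY : ∀ w, (Y w)ᴴ = -Y w) (hZ : ∀ w, (Z w)ᴴ = -Z w)
    {p : ((Fin (2 * L - 1 + 1) → GaugeConfig 3 L SU2) × (Site 3 L → SU2))} (hp : ringDeficit L (fun _ => false) p = 0) :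
    frameD Y (frameD Z (ringPoly L)) (ringCoord L p) = frameD Z (frameD Y (ringPoly L)) (ringCoord L p) := by
  have h := frameD_comm (contDiff_ringPoly (L := L)) Y Z (ringCoord L p)
  rw [frameD_ringPoly_eq_zero_of_zero (commDir Y Z) (commDir_conjTranspose hY hZ) (commDir_trace Y Z) hp] at h
  linarith

end Summit.QuantumFields.YangMills.Theorems.VirialFluxGap.FrameHessian

end
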